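import Summits.CriticalPhenomena.SAWScalingLimit.Theorems.SAWRenewalTightnessTubeLowerBoundConeToDiamond

/-!
# Crux `TubeLowerBound` (stmt-CriticalPhenomena-4730), line `subcritical-renewal-floor`:
# sub-goal `wedgeSlabFloor_of_coneBridgeFloor` ((F3) `ConeBridgeFloor` ⇒ (F2) wedge-slab floor)

The hypothesis (F3) is a polynomial floor `c s^{-C}` for the `x_c`-mass of CONE BRIDGES `0 → (s, t)`,
`|t| ≤ κ s` (bridges `0 < x(i) ≤ s` at times `i ≥ 1`, inside the tube `|y − (t/s) x| ≤ κ s/4 + 1`, with the end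
cone `4|y(i) − t| ≤ s − x(i)`); any witness has `κ ≤ 1/4` (`Negative.coneBridgeFloor_kappa_le`).  The conclusion
(F2) is verbatim the open stub `BridgeDoublingTower.stub_wedgeSlabFloor` of the sibling line `bridge-doubling-tower`
(the hypothesis of the landed `BridgeDoublingTower.stub_doublingUpgrade`): the WEDGE-SLAB family of self-avoiding
walks from `0` ending on the column `x = l`, in the start wedge `|y| < x ≤ l` at times `1 ≤ i ≤ n` and in the tube
`5|y| ≤ l` at all times `≤ n`, has `x_c`-mass `≥ c' l^{-C'}`.

Proof.  Only `t = 0` is used.  For `l ≥ 8` the landed first half of `stub_coneToDiamond`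
(`ConeToDiamond.coneMass_le_coBridgeMass`: rotate a cone bridge `β : 0 → (l, 0)` by `π` and run it backwards,
`υ(i) = (l, 0) − β(n − i)`, injectively) bounds the cone mass by the mass of self-avoiding walks `0 → (l, 0)` with
the START-cone site predicate `0 ≤ x ≤ l`, `4|y| ≤ x`, `16|y| ≤ l + 16` at all times `≤ n`.  Such a walk is in the
wedge-slab family (`WedgeOfCone.coBridgeMass_le_wedgeMass`): `ω(n) = (l, 0)`; at a time `1 ≤ i ≤ n` the point is not
`ω(0) = 0` (self-avoidance), so `4|y| ≤ x`, `x ≥ 0` force `x ≥ 1` and `|y| ≤ x/4 < x`; and `16|y| ≤ l + 16` with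
`l ≥ 8` gives `80|y| ≤ 5l + 80 ≤ 16 l`, i.e. `5|y| ≤ l`.  For `1 ≤ l < 8` the straight walk `i ↦ (min i l, 0)` is in
the family (`WedgeOfCone.wedge_straight_term`), with mass `x_c^l ≥ x_c^8` (`x_c ≤ 1` because `μ ≥ 1`).
Constants: `C' = max(C, 0)`, `c' = min(c, x_c^8)`, cut-off `N` of the hypothesis at `(l, 0)` (resp. `l`).
-/

noncomputable section

namespace Summit.CriticalPhenomena.SAWScalingLimit.Theorems.TubeLowerBound.SubcriticalRenewalFloor

open scoped BigOperators Classical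
open Literature.Probability.LatticeModels
open Literature.Probability.RandomPlanarGeometry Literature.Probability.RandomPlanarGeometry.SAW

namespace WedgeOfCone

open Literature.Probability.Percolation.Contour (site_ext)

/-- **Start-cone walks are wedge-slab walks (`l ≥ 8`).**  A self-avoiding walk `0 → (l, 0)` all of whose points
satisfy `0 ≤ x ≤ l`, `4|y| ≤ x`, `16|y| ≤ l + 16` ends on the column `x = l`, lies in the start wedge
`|y| < x ≤ l` at times `1 ≤ i ≤ n` (the point is not `ω(0) = 0` by self-avoidance, so `x ≥ 1` and
`|y| ≤ x/4 < x`), and in the tube `5|y| ≤ l` (`80|y| ≤ 5l + 80 ≤ 16l` for `l ≥ 8`); so the masses compare. -/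
theorem coBridgeMass_le_wedgeMass (l : ℕ) (hl : 8 ≤ l) (N : ℕ) :
    (∑ n ∈ Finset.range (N + 1),
        ∑ _ω ∈ (Zd.sawFun 2 n ![(l : ℤ), 0]).filter (fun ω => ∀ i ≤ n,
            0 ≤ ω i 0 ∧ ω i 0 ≤ (l : ℤ) ∧ 4 * |ω i 1| ≤ ω i 0 ∧ 16 * |ω i 1| ≤ (l : ℤ) + 16),
          criticalFugacity ^ n) ≤
      ∑ n ∈ Finset.range (N + 1),
        ∑ _ω ∈ (SAW.Zd.saws 2 n).filter (fun ω =>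
            ω n 0 = (l : ℤ) ∧
            (∀ i, 1 ≤ i → i ≤ n → |ω i 1| < ω i 0 ∧ ω i 0 ≤ (l : ℤ)) ∧
            (∀ i ≤ n, 5 * |ω i 1| ≤ (l : ℤ))),
          SAW.criticalFugacity ^ n := by
  refine Finset.sum_le_sum fun n _ => Finset.sum_le_sum_of_subset_of_nonneg (fun ω hω => ?_)
    fun _ _ _ => pow_nonneg criticalFugacity_pos.le n
  rw [Finset.mem_filter] at hω ⊢
  obtain ⟨hωF, hR⟩ := hω
  obtain ⟨hωs, hωn⟩ := Zd.mem_sawFun_iff_mem_saws.1 hωF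
  obtain ⟨h0, -, -, hinj⟩ := Zd.mem_saws.1 hωs
  refine ⟨hωs, by simp [hωn], fun i h1 h2 => ?_, fun i hi => ?_⟩
  · obtain ⟨hx0, hxl, h4, -⟩ := hR i h2
    have hne : ω i ≠ ω 0 := fun he => by
      have := hinj (show i ≤ n from h2) (Nat.zero_le n) he
      omega
    have ha := le_abs_self (ω i 1)
    have hb := neg_abs_le (ω i 1)
    have hx : ω i 0 ≠ 0 := fun e0 => by
      have e1 : |ω i 1| = 0 := by omega
      exact hne (by rw [h0]; exact site_ext e0 (abs_eq_zero.1 e1))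
    constructor <;> omega
  · obtain ⟨-, -, -, h16⟩ := hR i hi
    have h8 : (8 : ℤ) ≤ (l : ℤ) := by exact_mod_cast hl
    omega

/-- **The straight walk is a wedge-slab walk.**  `i ↦ (min i l, 0)` is an `l`-step self-avoiding walk from `0`
ending on the column `x = l`, with `|0| < i ≤ l` at times `1 ≤ i ≤ l` and `5 · 0 ≤ l`; hence
`x_c^l ≤ Σ_{n ≤ l} Σ_{wedge-slab walks of length n} x_c^n`. -/
theorem wedge_straight_term (l : ℕ) :
    SAW.criticalFugacity ^ l ≤
      ∑ n ∈ Finset.range (l + 1),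
        ∑ _ω ∈ (SAW.Zd.saws 2 n).filter (fun ω =>
            ω n 0 = (l : ℤ) ∧
            (∀ i, 1 ≤ i → i ≤ n → |ω i 1| < ω i 0 ∧ ω i 0 ≤ (l : ℤ)) ∧
            (∀ i ≤ n, 5 * |ω i 1| ≤ (l : ℤ))),
          SAW.criticalFugacity ^ n := by
  have hval : ∀ i ≤ l, SAW.Zd.straightWalk 2 l i 0 = (i : ℤ) ∧ SAW.Zd.straightWalk 2 l i 1 = 0 := by
    intro i hi
    rw [show SAW.Zd.straightWalk 2 l i = Pi.single 0 (i : ℤ) by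
      simp [SAW.Zd.straightWalk, min_eq_left hi]]
    simp only [Pi.single_eq_same, Pi.single_eq_of_ne (show (1 : Fin 2) ≠ 0 by decide), and_self]
  have hmem : SAW.Zd.straightWalk 2 l ∈ (SAW.Zd.saws 2 l).filter (fun ω =>
      ω l 0 = (l : ℤ) ∧
      (∀ i, 1 ≤ i → i ≤ l → |ω i 1| < ω i 0 ∧ ω i 0 ≤ (l : ℤ)) ∧
      (∀ i ≤ l, 5 * |ω i 1| ≤ (l : ℤ))) := by
    rw [Finset.mem_filter]
    refine ⟨SAW.Zd.straightWalk_mem_saws 2 l, (hval l le_rfl).1, fun i h1 h2 => ?_, fun i hi => ?_⟩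
    · rw [(hval i h2).1, (hval i h2).2, abs_zero]
      exact ⟨by exact_mod_cast h1, by exact_mod_cast h2⟩
    · rw [(hval i hi).2, abs_zero, mul_zero]
      exact Nat.cast_nonneg l
  calc SAW.criticalFugacity ^ l
      ≤ ∑ _ω ∈ (SAW.Zd.saws 2 l).filter (fun ω =>
            ω l 0 = (l : ℤ) ∧
            (∀ i, 1 ≤ i → i ≤ l → |ω i 1| < ω i 0 ∧ ω i 0 ≤ (l : ℤ)) ∧
            (∀ i ≤ l, 5 * |ω i 1| ≤ (l : ℤ))),
          SAW.criticalFugacity ^ l :=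
        Finset.single_le_sum (f := fun _ => SAW.criticalFugacity ^ l)
          (fun _ _ => pow_nonneg SAW.criticalFugacity_pos.le l) hmem
    _ ≤ _ :=
        Finset.single_le_sum (f := fun n => ∑ _ω ∈ (SAW.Zd.saws 2 n).filter (fun ω =>
            ω n 0 = (l : ℤ) ∧
            (∀ i, 1 ≤ i → i ≤ n → |ω i 1| < ω i 0 ∧ ω i 0 ≤ (l : ℤ)) ∧
            (∀ i ≤ n, 5 * |ω i 1| ≤ (l : ℤ))), SAW.criticalFugacity ^ n)
          (fun n _ => Finset.sum_nonneg fun _ _ => pow_nonneg SAW.criticalFugacity_pos.le n)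
          (Finset.mem_range.2 (Nat.lt_succ_self l))

end WedgeOfCone

/-- **Sub-goal `wedgeSlabFloor_of_coneBridgeFloor` of the line `subcritical-renewal-floor`: (F3) ⇒ (F2).**
If cone bridges `0 → (s, t)`, `|t| ≤ κ s` (bridges inside the tube `|y − (t/s)x| ≤ κ s/4 + 1` with the end cone
`4|y − t| ≤ s − x`) have `x_c`-mass `≥ c s^{−C}` for every `s ≥ 1`, then for every `l ≥ 1` the wedge-slab family
(self-avoiding walks from `0` ending on the column `x = l`, in the start wedge `|y| < x ≤ l` at times `1 ≤ i ≤ n`,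
in the tube `5|y| ≤ l` at all times `≤ n`) has `x_c`-mass `≥ min(c, x_c^8) l^{−max(C, 0)}`: for `l ≥ 8` the
co-bridges (rotation by `π` + time reversal) of the cone bridges at `(l, 0)` (`t = 0`, `κ ≤ 1/4`), for `l < 8` the
straight walk. -/
theorem wedgeSlabFloor_of_coneBridgeFloor :
    (∃ κ C c : ℝ, 0 < κ ∧ 0 < c ∧ ∀ (s : ℕ) (t : ℤ), 1 ≤ s → |(t : ℝ)| ≤ κ * s → ∃ N : ℕ, c * (s : ℝ) ^ (-C) ≤ ∑ n ∈ Finset.range (N + 1), ∑ _ω ∈ (Zd.bridges 2 n).filter (fun ω => ω n = ![(s : ℤ), t] ∧ ∀ i ≤ n, |((ω i 1 : ℤ) : ℝ) - (t : ℝ) / (s : ℝ) * ((ω i 0 : ℤ) : ℝ)| ≤ κ * s / 4 + 1 ∧ 4 * |ω i 1 - t| ≤ (s : ℤ) - ω i 0), criticalFugacity ^ n) → ∃ C c : ℝ, 0 ≤ C ∧ 0 < c ∧ ∀ l : ℕ, 1 ≤ l → ∃ N : ℕ, c * (l : ℝ) ^ (-C) ≤ ∑ n ∈ Finset.range (N +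 1), ∑ _ω ∈ (SAW.Zd.saws 2 n).filter (fun ω => ω n 0 = (l : ℤ) ∧ (∀ i, 1 ≤ i → i ≤ n → |ω i 1| < ω i 0 ∧ ω i 0 ≤ (l : ℤ)) ∧ (∀ i ≤ n, 5 * |ω i 1| ≤ (l : ℤ))), SAW.criticalFugacity ^ n := by
  rintro ⟨κ, C, c, hκ, hc, h⟩
  have hκ4 : κ ≤ 1 / 4 := Negative.coneBridgeFloor_kappa_le hc h
  have hx0 : 0 < criticalFugacity := criticalFugacity_pos
  have hx1 : criticalFugacity ≤ 1 :=
    inv_le_one_of_one_le₀ (Zd.connectiveConstant_two ▸ Zd.one_le_connectiveConstant 2)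
  have hC₀ : 0 ≤ max C 0 := le_max_right _ _
  refine ⟨max C 0, min c (criticalFugacity ^ 8), hC₀, lt_min hc (pow_pos hx0 8), fun l hl => ?_⟩
  have hl1 : (1 : ℝ) ≤ l := by exact_mod_cast hl
  rcases lt_or_ge l 8 with hl8 | hl8
  · -- small spans: the straight walk
    refine ⟨l, le_trans ?_ (WedgeOfCone.wedge_straight_term l)⟩
    calc min c (criticalFugacity ^ 8) * (l : ℝ) ^ (-max C 0)
        ≤ min c (criticalFugacity ^ 8) :=
          mul_le_of_le_one_right (le_min hc.le (by positivity))
            (Real.rpow_le_one_of_one_le_of_nonpos hl1 (by linarith))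
      _ ≤ criticalFugacity ^ 8 := min_le_right _ _
      _ ≤ criticalFugacity ^ l := pow_le_pow_of_le_one hx0.le hx1 hl8.le
  · -- large spans: co-bridges of the cone bridges at `(l, 0)`
    have ht0 : |((0 : ℤ) : ℝ)| ≤ κ * l := by
      rw [Int.cast_zero, abs_zero]; positivity
    obtain ⟨N, hN⟩ := h l 0 hl ht0
    refine ⟨N, le_trans ?_ ((hN.trans (ConeToDiamond.coneMass_le_coBridgeMass hκ4 l rfl N)).trans
      (WedgeOfCone.coBridgeMass_le_wedgeMass l hl8 N))⟩
    calc min c (criticalFugacity ^ 8) * (l : ℝ) ^ (-max C 0)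
        ≤ c * (l : ℝ) ^ (-max C 0) :=
          mul_le_mul_of_nonneg_right (min_le_left _ _) (Real.rpow_nonneg (Nat.cast_nonneg l) _)
      _ ≤ c * (l : ℝ) ^ (-C) :=
          mul_le_mul_of_nonneg_left
            (Real.rpow_le_rpow_of_exponent_le hl1 (neg_le_neg (le_max_left _ _))) hc.le

end Summit.CriticalPhenomena.SAWScalingLimit.Theorems.TubeLowerBound.SubcriticalRenewalFloor

end
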